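import Mathlib
import Summits.Ventures.HodgeRepro.Tier4.Common.AdelicDefs
import Summits.Ventures.HodgeRepro.Tier4.Line1.PlaneDefs
import Summits.Ventures.HodgeRepro.Tier4.Line1.C7Components

/-!
# Tier4/Line1/C7Reconstruct — (C7.3c) a family of local unitary matrices, integral almost everywhere, is adelic

Blind re-derivation cell `pub-hodge-repro`, Tier 4 (README §9–§10), seat t4-L1-p2 (prover, LINE L1, gen 0).
Rung C7.3c of t4-L1-p4's typed census of the fibration wall C7 (`proofs/t4/L1/C7-rungs-sig.lean` L177–L184, S12903;
assignment S12903/S12946): local unitary matrices `κ_v ∈ U(W)(k_v)`, `κ_w ∈ U(W)(k_w)`, integral outside a finite `S`,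
are the components of ONE `κ ∈ U(W)(𝔸_k)`.  PROOF: the adelic matrix `M` with entries `((κ_w)_{ij})_w, ((κ_v)_{ij})_v`
(`RestrictedProduct.mk`, eventually integral); evaluation at a place is a ring homomorphism (p4's `finHom`/`infHom`),
so the two equations of `unitaryGroup W` hold for `M` because they hold at every place (p4's `mat_ext_of_components`,
`finMat_mul`, `finMat_transpose`, `finMat_adMat` and the infinite twins); `det M · det M = 1` place by place
(`h B hᵀ = B`, `det B ≠ 0` from `IsDefinite`), so `M ∈ GL₄(𝔸_k)` (`Matrix.isUnit_iff_isUnit_det`).  Components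
`finMat`, `infMat` and the local groups `localU`, `localUInf`, `localUInt` are p4's (`C7Components.lean` p672122).
HC_CM is NOT proved by anyone in this repository.
-/

set_option autoImplicit false

noncomputable section

namespace Summit.Ventures.HodgeRepro.Tier4.Line1

open NumberField IsDedekindDomain HeightOneSpectrum Topology Common Matrix

section Reconstruct

variable {k : Type} [Field k] [NumberField k] (W : PlaneData k)

omit [NumberField k] in
/-- a definite plane has `det B ≠ 0` (a positive or negative definite real matrix has positive or `(-1)^4`-positive
determinant, and `σ (det B) = det (B.map σ)`) -/
theorem det_B_ne_zero_of_isDefinite (hW : IsDefinite W) : W.B.det ≠ 0 := by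
  obtain ⟨σ, h | h⟩ := hW
  · intro h0
    have h1 : (W.B.map σ).det = σ W.B.det := (RingHom.map_det σ W.B).symm
    have h2 := h.det_pos
    rw [h1, h0, map_zero] at h2
    exact lt_irrefl _ h2
  · intro h0
    have h1 : (W.B.map σ).det = σ W.B.det := (RingHom.map_det σ W.B).symm
    have h2 := h.det_pos
    rw [Matrix.det_neg, h1, h0, map_zero, mul_zero] at h2
    exact lt_irrefl _ h2

/-- the determinant of the infinite component is the component of the determinant -/
theorem det_infMat (w : InfinitePlace k) (M : M4 k) : (infMat w M).det = (M.det).1 w := by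
  rw [infMat_eq_map, ← infHom_apply, RingHom.map_det]
  rfl

/-- the determinant of the finite component is the component of the determinant -/
theorem det_finMat (v : HeightOneSpectrum (𝓞 k)) (M : M4 k) : (finMat v M).det = (M.det).2 v := by
  rw [finMat_eq_map, ← finHom_apply, RingHom.map_det]
  rfl

/-- a local unitary matrix at a finite place has `det h · det h = 1` when `det B ≠ 0` -/
theorem det_mul_self_of_mem_localU (hB : W.B.det ≠ 0) (v : HeightOneSpectrum (𝓞 k))
    {h : Matrix (Fin 4) (Fin 4) (v.adicCompletion k)} (hh : h ∈ localU W v) : h.det * h.det = 1 := by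
  have h2 := congrArg Matrix.det hh.2
  rw [Matrix.det_mul, Matrix.det_mul, Matrix.det_transpose] at h2
  have hB' : (W.B.map (algebraMap k (v.adicCompletion k))).det ≠ 0 := by
    rw [← RingHom.mapMatrix_apply, ← RingHom.map_det]
    exact (map_ne_zero _).2 hB
  have h3 : (h.det * h.det) * (W.B.map (algebraMap k (v.adicCompletion k))).det =
      1 * (W.B.map (algebraMap k (v.adicCompletion k))).det := by
    rw [one_mul]
    calc (h.det * h.det) * (W.B.map (algebraMap k (v.adicCompletion k))).det
        = h.det * (W.B.map (algebraMap k (v.adicCompletion k))).det * h.det := by ring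
      _ = (W.B.map (algebraMap k (v.adicCompletion k))).det := h2
  exact mul_right_cancel₀ hB' h3

omit [NumberField k] in
/-- a local unitary matrix at an infinite place has `det h · det h = 1` when `det B ≠ 0` -/
theorem det_mul_self_of_mem_localUInf (hB : W.B.det ≠ 0) (w : InfinitePlace k)
    {h : Matrix (Fin 4) (Fin 4) w.Completion} (hh : h ∈ localUInf W w) : h.det * h.det = 1 := by
  have h2 := congrArg Matrix.det hh.2
  rw [Matrix.det_mul, Matrix.det_mul, Matrix.det_transpose] at h2
  have hB' : (W.B.map (algebraMap k w.Completion)).det ≠ 0 := by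
    rw [← RingHom.mapMatrix_apply, ← RingHom.map_det]
    exact (map_ne_zero _).2 hB
  have h3 : (h.det * h.det) * (W.B.map (algebraMap k w.Completion)).det =
      1 * (W.B.map (algebraMap k w.Completion)).det := by
    rw [one_mul]
    calc (h.det * h.det) * (W.B.map (algebraMap k w.Completion)).det
        = h.det * (W.B.map (algebraMap k w.Completion)).det * h.det := by ring
      _ = (W.B.map (algebraMap k w.Completion)).det := h2
  exact mul_right_cancel₀ hB' h3

/-- **(C7.3c) RECONSTRUCTION**: a family of local unitary matrices, integral outside the finite set `S`, is the family
of components of one element of `U(W)(𝔸_k)` (statement = t4-L1-p4's `C7-rungs-sig.lean` L177–L184). -/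
theorem exists_GA_of_local (hW : IsDefinite W) (S : Finset (HeightOneSpectrum (𝓞 k)))
    (κf : ∀ v : HeightOneSpectrum (𝓞 k), Matrix (Fin 4) (Fin 4) (v.adicCompletion k))
    (κi : ∀ w : InfinitePlace k, Matrix (Fin 4) (Fin 4) w.Completion)
    (hκf : ∀ v, κf v ∈ localU W v) (hκi : ∀ w, κi w ∈ localUInf W w)
    (hint : ∀ v ∉ S, κf v ∈ localUInt W v) :
    ∃ κ : GA W, (∀ v, finMat v (GA.mat W κ) = κf v) ∧ ∀ w, infMat w (GA.mat W κ) = κi w := by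
  classical
  have hB : W.B.det ≠ 0 := det_B_ne_zero_of_isDefinite W hW
  -- the entries are eventually integral
  have hev : ∀ i j, ∀ᶠ v in Filter.cofinite, κf v i j ∈ v.adicCompletionIntegers k := by
    intro i j
    refine Filter.eventually_cofinite.2 (S.finite_toSet.subset fun v hv => ?_)
    by_contra hvS
    exact hv ((hint v hvS).2 i j)
  -- the adelic matrix
  let M : M4 k := fun i j => ((fun w => κi w i j : InfiniteAdeleRing k),
    (⟨fun v => κf v i j, hev i j⟩ : FiniteAdeleRing (𝓞 k) k))
  have hMinf : ∀ w, infMat w M = κi w := fun w => rfl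
  have hMfin : ∀ v, finMat v M = κf v := fun v => rfl
  -- the two equations of the unitary group, checked place by place
  have hΩ : M * adMat k W.Ω = adMat k W.Ω * M := by
    refine mat_ext_of_components (fun v => ?_) (fun w => ?_)
    · rw [finMat_mul, finMat_mul, hMfin, finMat_adMat]
      exact (hκf v).1
    · rw [infMat_mul, infMat_mul, hMinf, infMat_adMat]
      exact (hκi w).1
  have hBeq : M * adMat k W.B * Mᵀ = adMat k W.B := by
    refine mat_ext_of_components (fun v => ?_) (fun w => ?_)
    · rw [finMat_mul, finMat_mul, finMat_transpose, hMfin, finMat_adMat]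
      exact (hκf v).2
    · rw [infMat_mul, infMat_mul, infMat_transpose, hMinf, infMat_adMat]
      exact (hκi w).2
  -- invertibility: `det M · det M = 1` place by place
  have hdet : M.det * M.det = 1 := by
    refine Prod.ext (funext fun w => ?_) (FiniteAdeleRing.ext k fun v => ?_)
    · have h1 : (M.det * M.det).1 w = (infMat w M).det * (infMat w M).det := by
        rw [det_infMat]; rfl
      rw [h1, hMinf]
      exact det_mul_self_of_mem_localUInf W hB w (hκi w)
    · have h1 : (M.det * M.det).2 v = (finMat v M).det * (finMat v M).det := by
        rw [det_finMat]; rfl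
      rw [h1, hMfin]
      exact det_mul_self_of_mem_localU W hB v (hκf v)
  have hunit : IsUnit M := (Matrix.isUnit_iff_isUnit_det M).2 (IsUnit.of_mul_eq_one _ hdet)
  let u : GL4 k := hunit.unit
  have hu : (↑u : M4 k) = M := hunit.unit_spec
  have hmem : u ∈ unitaryGroup W := by
    rw [mem_unitaryGroup, hu]
    exact ⟨hΩ, hBeq⟩
  refine ⟨⟨u, hmem⟩, fun v => ?_, fun w => ?_⟩
  · show finMat v (↑u : M4 k) = κf v
    rw [hu]
    exact hMfin v
  · show infMat w (↑u : M4 k) = κi w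
    rw [hu]
    exact hMinf w

end Reconstruct

end Summit.Ventures.HodgeRepro.Tier4.Line1

end
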